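/-
Copyright (c) 2026 the pub-hodgecm-mathlib formalisation cell (harness21).  Prover seat hodgecm-mathlib-K2Liu-p14 (g3), Track B «K2-LIT»,
#184♮ = hLiu418 = `stmt-HodgeConjecture-24832`; Road I v3, S5-F3 lineage ∕ I4-conv (F′-fact), FILE B2: the transport calculus of place components (proof lane).
-/
import Summits.HodgeConjecture.HodgeConjecture.Theorems.K2LiuKlingenInnerSectionLocalDefs   -- ★ FILE B: `psiLoc`, `evalPlace_finPart_eq_psiLoc`, `evalPlace_finPart_eq_evalAt`
import Literature.NumberTheory.Automorphic.UnitaryGroupAdelicProduct                      -- ★ `archPart`, `archToAdelic`, `adelicProdEquiv`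
import HarnessLib

/-!
# Crux `HLiu418`, I4-conv (F′-fact), FILE B2 — `K2LiuKlingenInnerSectionLocalTransport`: THE TRANSPORT CALCULUS OF PLACE COMPONENTS for a homomorphism
# `Ψ : U(J)(𝔸) → U(J′)(𝔸)` PINNED as conjugation by an adelic matrix (the F-files' `hΨ`): `Ψ⁻¹` is pinned by `S_𝔸⁻¹`, `Ψ⁻¹_v ∘ Ψ_v = id`, `(Ψ g)_∞` sees only `g_∞`,
# and `Ψ(ι_v u) = ι_v(Ψ_v u)`

Cell `hodgecm-mathlib`, crux item hLiu418 = `stmt-HodgeConjecture-24832`; squad K2 ∕ K2Liu; LEAD F0P6-plan (g14) BATCH #36; prover K2Liu-p14 (g3).  THEOREMS ONLY (no `def`,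
no instance, no notation, no named-fact hypothesis, no `sorry`); lane `--supports stmt-HodgeConjecture-24832 --as helper` (count-neutral).
Consumers: the `hK`∕`hlaw` payers of F0P2-p10's C `K2LiuKlingenInnerSectionSpherical` (★ FILE B's `psiLoc Ψ v` maps `U(J₄)(𝒪_v)` and the local Borel through
`Ψ(ι_v ·) = ι_v(Ψ_v ·)` to the GLOBAL pins `hΨP`∕`hΨK` of the F-files), FILE E (`(Ψ_S⁻¹ x)_v = Ψ_{S,v}⁻¹ x_v`), and every later place-by-place transport.
* `pin_units` (the pin in `GL_N(𝔸_L)`), **`pin_symm`** (the inverse transport is pinned by `S_𝔸⁻¹`, in the verbatim `hΨ` shape),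
* **`psiLoc_symm_psiLoc`**, **`psiLoc_psiLoc_symm`** (`Ψ⁻¹_v ∘ Ψ_v = id = Ψ_v ∘ Ψ⁻¹_v`),
* `archPart_eq_archPart_archToAdelic` (`(Ψ g)_∞ = (Ψ(g_∞, 1))_∞`),
* **`apply_inclPlaceAdelic_eq`** (`Ψ(ι_v u) = ι_v(Ψ_v u)`; ★ `adelicProdEquiv`, ★ `eq_of_forall_evalPlace_eq`).
[BorelJacquet1979, §4.1], [PlatonovRapinchuk1994, §5.1], [CasselsFrohlichANT1967, Ch. II §10–§11].
HONEST LABEL.  Count-neutral helper, closes no socket: `HC_CM` is proved only modulo the 7 printed citations (2 remaining named inputs: hLiu418 =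
`stmt-HodgeConjecture-24832`, h413 = `stmt-HodgeConjecture-24833`) until rung 0 closes.
-/

set_option autoImplicit false
set_option linter.dupNamespace false -- the mandated namespace repeats `HodgeConjecture.HodgeConjecture`

noncomputable section

open scoped Matrix
open NumberField IsDedekindDomain

namespace Summit.HodgeConjecture.HodgeConjecture.Cruxes.HLiu418.K2LiuKlingenInnerSectionLocalTransport

open Literature.NumberTheory.Automorphic Literature.NumberTheory.Automorphic.UnitaryGroup
open Literature.NumberTheory.GelbartRogawski1991 Literature.NumberTheory.GelbartRogawski1991.GRConstruction
open Summit.HodgeConjecture.HodgeConjecture.Cruxes.HLiu418.K2LiuKlingenInnerSectionLocalDefs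

variable (L : Type) [Field L] [NumberField L] [IsCMField L]

section TransportCalculus

variable {N : ℕ} {J J' J'' : Matrix (Fin N) (Fin N) L}

/-- the F-files' matrix pin `hΨ` in `GL_N(𝔸_L)` form: `(Ψ g) = S_𝔸 · g · S_𝔸⁻¹` as invertible matrices. [cite: BorelJacquet1979, §4.1] -/
theorem pin_units
    (Ψ : (adelicGroupData (Fp L) L (IsCMField.complexConj L) N J).Adelic →* (adelicGroupData (Fp L) L (IsCMField.complexConj L) N J').Adelic)
    (SA : GL (Fin N) (AdeleRing (𝓞 L) L))
    (hΨ : ∀ g : (adelicGroupData (Fp L) L (IsCMField.complexConj L) N J).Adelic,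
      (((Ψ g).1 : GL (Fin N) (AdeleRing (𝓞 L) L)) : Matrix (Fin N) (Fin N) (AdeleRing (𝓞 L) L)) =
        (SA : Matrix (Fin N) (Fin N) (AdeleRing (𝓞 L) L)) *
          ((adelicVal (Fp L) L (IsCMField.complexConj L) N J g : GL (Fin N) (AdeleRing (𝓞 L) L)) : Matrix (Fin N) (Fin N) (AdeleRing (𝓞 L) L)) *
          ((SA⁻¹ : GL (Fin N) (AdeleRing (𝓞 L) L)) : Matrix (Fin N) (Fin N) (AdeleRing (𝓞 L) L)))
    (g : (adelicGroupData (Fp L) L (IsCMField.complexConj L) N J).Adelic) :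
    ((Ψ g).1 : GL (Fin N) (AdeleRing (𝓞 L) L)) = SA * g.1 * SA⁻¹ :=
  Units.ext (by rw [hΨ g, Units.val_mul, Units.val_mul, adelicVal_apply])

/-- **the pin of the INVERSE transport**: if `Ψ` is conjugation by `S_𝔸` then `Ψ⁻¹` is conjugation by `S_𝔸⁻¹` (in the verbatim shape of the F-files' `hΨ`, so that every
`hΨ`-lemma applies to `Ψ.symm` with `SA⁻¹`). [cite: BorelJacquet1979, §4.1] -/
theorem pin_symm
    (Ψ : (adelicGroupData (Fp L) L (IsCMField.complexConj L) N J).Adelic ≃* (adelicGroupData (Fp L) L (IsCMField.complexConj L) N J').Adelic)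
    (SA : GL (Fin N) (AdeleRing (𝓞 L) L))
    (hΨ : ∀ g : (adelicGroupData (Fp L) L (IsCMField.complexConj L) N J).Adelic,
      (((Ψ g).1 : GL (Fin N) (AdeleRing (𝓞 L) L)) : Matrix (Fin N) (Fin N) (AdeleRing (𝓞 L) L)) =
        (SA : Matrix (Fin N) (Fin N) (AdeleRing (𝓞 L) L)) *
          ((adelicVal (Fp L) L (IsCMField.complexConj L) N J g : GL (Fin N) (AdeleRing (𝓞 L) L)) : Matrix (Fin N) (Fin N) (AdeleRing (𝓞 L) L)) *
          ((SA⁻¹ : GL (Fin N) (AdeleRing (𝓞 L) L)) : Matrix (Fin N) (Fin N) (AdeleRing (𝓞 L) L)))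
    (g' : (adelicGroupData (Fp L) L (IsCMField.complexConj L) N J').Adelic) :
    (((Ψ.symm g').1 : GL (Fin N) (AdeleRing (𝓞 L) L)) : Matrix (Fin N) (Fin N) (AdeleRing (𝓞 L) L)) =
      ((SA⁻¹ : GL (Fin N) (AdeleRing (𝓞 L) L)) : Matrix (Fin N) (Fin N) (AdeleRing (𝓞 L) L)) *
        ((adelicVal (Fp L) L (IsCMField.complexConj L) N J' g' : GL (Fin N) (AdeleRing (𝓞 L) L)) : Matrix (Fin N) (Fin N) (AdeleRing (𝓞 L) L)) *
        ((SA⁻¹⁻¹ : GL (Fin N) (AdeleRing (𝓞 L) L)) : Matrix (Fin N) (Fin N) (AdeleRing (𝓞 L) L)) := by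
  have h := pin_units L Ψ.toMonoidHom SA hΨ (Ψ.symm g')
  rw [MulEquiv.coe_toMonoidHom, MulEquiv.apply_symm_apply] at h
  have h' : ((Ψ.symm g').1 : GL (Fin N) (AdeleRing (𝓞 L) L)) = SA⁻¹ * g'.1 * SA⁻¹⁻¹ := by
    rw [h, inv_inv]; group
  rw [h', Units.val_mul, Units.val_mul, adelicVal_apply]

/-- **`Ψ⁻¹_v ∘ Ψ_v = id`**: the place components of a pinned transport and of its inverse are mutually inverse. [cite: BorelJacquet1979, §4.1] [cite: PlatonovRapinchuk1994, §5.1] -/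
theorem psiLoc_symm_psiLoc
    (Ψ : (adelicGroupData (Fp L) L (IsCMField.complexConj L) N J).Adelic ≃* (adelicGroupData (Fp L) L (IsCMField.complexConj L) N J').Adelic)
    (SA : GL (Fin N) (AdeleRing (𝓞 L) L))
    (hΨ : ∀ g : (adelicGroupData (Fp L) L (IsCMField.complexConj L) N J).Adelic,
      (((Ψ g).1 : GL (Fin N) (AdeleRing (𝓞 L) L)) : Matrix (Fin N) (Fin N) (AdeleRing (𝓞 L) L)) =
        (SA : Matrix (Fin N) (Fin N) (AdeleRing (𝓞 L) L)) *
          ((adelicVal (Fp L) L (IsCMField.complexConj L) N J g : GL (Fin N) (AdeleRing (𝓞 L) L)) : Matrix (Fin N) (Fin N) (AdeleRing (𝓞 L) L)) *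
          ((SA⁻¹ : GL (Fin N) (AdeleRing (𝓞 L) L)) : Matrix (Fin N) (Fin N) (AdeleRing (𝓞 L) L)))
    (v : HeightOneSpectrum (𝓞 (Fp L))) (u : UnitaryGroup.localPi L (IsCMField.complexConj L) N J v) :
    psiLoc L Ψ.symm.toMonoidHom v (psiLoc L Ψ.toMonoidHom v u) = u := by
  have h1 := evalPlace_finPart_eq_psiLoc L Ψ.symm.toMonoidHom SA⁻¹ (pin_symm L Ψ SA hΨ) v
    (Ψ (UnitaryGroup.inclPlaceAdelic (Fp L) L (IsCMField.complexConj L) N J v u))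
  rw [MulEquiv.coe_toMonoidHom, MulEquiv.symm_apply_apply, UnitaryGroup.evalPlace_finPart_inclPlaceAdelic] at h1
  rw [psiLoc_apply L Ψ.toMonoidHom, MulEquiv.coe_toMonoidHom]
  exact h1.symm

/-- **`Ψ_v ∘ Ψ⁻¹_v = id`**. [cite: BorelJacquet1979, §4.1] [cite: PlatonovRapinchuk1994, §5.1] -/
theorem psiLoc_psiLoc_symm
    (Ψ : (adelicGroupData (Fp L) L (IsCMField.complexConj L) N J).Adelic ≃* (adelicGroupData (Fp L) L (IsCMField.complexConj L) N J').Adelic)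
    (SA : GL (Fin N) (AdeleRing (𝓞 L) L))
    (hΨ : ∀ g : (adelicGroupData (Fp L) L (IsCMField.complexConj L) N J).Adelic,
      (((Ψ g).1 : GL (Fin N) (AdeleRing (𝓞 L) L)) : Matrix (Fin N) (Fin N) (AdeleRing (𝓞 L) L)) =
        (SA : Matrix (Fin N) (Fin N) (AdeleRing (𝓞 L) L)) *
          ((adelicVal (Fp L) L (IsCMField.complexConj L) N J g : GL (Fin N) (AdeleRing (𝓞 L) L)) : Matrix (Fin N) (Fin N) (AdeleRing (𝓞 L) L)) *
          ((SA⁻¹ : GL (Fin N) (AdeleRing (𝓞 L) L)) : Matrix (Fin N) (Fin N) (AdeleRing (𝓞 L) L)))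
    (v : HeightOneSpectrum (𝓞 (Fp L))) (x : UnitaryGroup.localPi L (IsCMField.complexConj L) N J' v) :
    psiLoc L Ψ.toMonoidHom v (psiLoc L Ψ.symm.toMonoidHom v x) = x := by
  have h1 := evalPlace_finPart_eq_psiLoc L Ψ.toMonoidHom SA hΨ v
    (Ψ.symm (UnitaryGroup.inclPlaceAdelic (Fp L) L (IsCMField.complexConj L) N J' v x))
  rw [MulEquiv.coe_toMonoidHom, MulEquiv.apply_symm_apply, UnitaryGroup.evalPlace_finPart_inclPlaceAdelic] at h1
  rw [psiLoc_apply L Ψ.symm.toMonoidHom, MulEquiv.coe_toMonoidHom]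
  exact h1.symm

/-- **the archimedean component of a pinned transport sees only the archimedean component**: `(Ψ g)_∞ = (Ψ (g_∞, 1))_∞` (both are `S_∞ g_∞ S_∞⁻¹`; ★ `coe_archPart`,
★ `archPart_archToAdelic`, `GLn.toMixed` a homomorphism). [cite: BorelJacquet1979, §4.1] -/
theorem archPart_eq_archPart_archToAdelic
    (Ψ : (adelicGroupData (Fp L) L (IsCMField.complexConj L) N J).Adelic →* (adelicGroupData (Fp L) L (IsCMField.complexConj L) N J').Adelic)
    (SA : GL (Fin N) (AdeleRing (𝓞 L) L))
    (hΨ : ∀ g : (adelicGroupData (Fp L) L (IsCMField.complexConj L) N J).Adelic,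
      (((Ψ g).1 : GL (Fin N) (AdeleRing (𝓞 L) L)) : Matrix (Fin N) (Fin N) (AdeleRing (𝓞 L) L)) =
        (SA : Matrix (Fin N) (Fin N) (AdeleRing (𝓞 L) L)) *
          ((adelicVal (Fp L) L (IsCMField.complexConj L) N J g : GL (Fin N) (AdeleRing (𝓞 L) L)) : Matrix (Fin N) (Fin N) (AdeleRing (𝓞 L) L)) *
          ((SA⁻¹ : GL (Fin N) (AdeleRing (𝓞 L) L)) : Matrix (Fin N) (Fin N) (AdeleRing (𝓞 L) L)))
    (g : (adelicGroupData (Fp L) L (IsCMField.complexConj L) N J).Adelic) :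
    UnitaryGroup.archPart (Fp L) L (IsCMField.complexConj L) N J' (Ψ g) =
      UnitaryGroup.archPart (Fp L) L (IsCMField.complexConj L) N J'
        (Ψ (UnitaryGroup.archToAdelic (Fp L) L (IsCMField.complexConj L) N J (UnitaryGroup.archPart (Fp L) L (IsCMField.complexConj L) N J g))) := by
  have ha : ((UnitaryGroup.archPart (Fp L) L (IsCMField.complexConj L) N J
      (UnitaryGroup.archToAdelic (Fp L) L (IsCMField.complexConj L) N J (UnitaryGroup.archPart (Fp L) L (IsCMField.complexConj L) N J g)) :
        UnitaryGroup.arch (Fp L) L (IsCMField.complexConj L) N J) : GL (Fin N) (NumberField.mixedEmbedding.mixedSpace L)) =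
      (UnitaryGroup.archPart (Fp L) L (IsCMField.complexConj L) N J g : GL (Fin N) (NumberField.mixedEmbedding.mixedSpace L)) := by
    rw [UnitaryGroup.archPart_archToAdelic]
  refine Subtype.ext ?_
  rw [UnitaryGroup.coe_archPart, UnitaryGroup.coe_archPart, adelicVal_apply, adelicVal_apply, pin_units L Ψ SA hΨ, pin_units L Ψ SA hΨ,
    map_mul, map_mul, map_mul, map_mul]
  congr 2
  rw [← adelicVal_apply, ← adelicVal_apply, ← UnitaryGroup.coe_archPart, ← UnitaryGroup.coe_archPart, ha]

set_option maxHeartbeats 1600000 in -- MEASURED: `rw` with the explicit-argument form of ★ `evalPlace_inclPlace_of_ne` (instance-path unification on `Fp L`)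
/-- **`Ψ(ι_v u) = ι_v(Ψ_v u)`**: a pinned transport carries the place-`v` inclusion to the place-`v` inclusion (archimedean components `1`, components off `v` equal `1`,
component at `v` = `Ψ_v u`; ★ `adelicProdEquiv`, ★ `eq_of_forall_evalPlace_eq`). [cite: BorelJacquet1979, §4.1] [cite: PlatonovRapinchuk1994, §5.1] -/
theorem apply_inclPlaceAdelic_eq
    (Ψ : (adelicGroupData (Fp L) L (IsCMField.complexConj L) N J).Adelic →* (adelicGroupData (Fp L) L (IsCMField.complexConj L) N J').Adelic)
    (SA : GL (Fin N) (AdeleRing (𝓞 L) L))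
    (hΨ : ∀ g : (adelicGroupData (Fp L) L (IsCMField.complexConj L) N J).Adelic,
      (((Ψ g).1 : GL (Fin N) (AdeleRing (𝓞 L) L)) : Matrix (Fin N) (Fin N) (AdeleRing (𝓞 L) L)) =
        (SA : Matrix (Fin N) (Fin N) (AdeleRing (𝓞 L) L)) *
          ((adelicVal (Fp L) L (IsCMField.complexConj L) N J g : GL (Fin N) (AdeleRing (𝓞 L) L)) : Matrix (Fin N) (Fin N) (AdeleRing (𝓞 L) L)) *
          ((SA⁻¹ : GL (Fin N) (AdeleRing (𝓞 L) L)) : Matrix (Fin N) (Fin N) (AdeleRing (𝓞 L) L)))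
    (v : HeightOneSpectrum (𝓞 (Fp L))) (u : UnitaryGroup.localPi L (IsCMField.complexConj L) N J v) :
    Ψ (UnitaryGroup.inclPlaceAdelic (Fp L) L (IsCMField.complexConj L) N J v u) =
      UnitaryGroup.inclPlaceAdelic (Fp L) L (IsCMField.complexConj L) N J' v (psiLoc L Ψ v u) := by
  apply (UnitaryGroup.adelicProdEquiv (Fp L) L (IsCMField.complexConj L) N J').injective
  rw [UnitaryGroup.adelicProdEquiv_apply, UnitaryGroup.adelicProdEquiv_apply, Prod.mk.injEq]
  constructor
  · rw [archPart_eq_archPart_archToAdelic L Ψ SA hΨ, UnitaryGroup.archPart_inclPlaceAdelic, UnitaryGroup.archPart_inclPlaceAdelic, map_one, map_one, map_one]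
  · rw [UnitaryGroup.finPart_inclPlaceAdelic]
    refine UnitaryGroup.eq_of_forall_evalPlace_eq (Fp L) L (IsCMField.complexConj L) N J' fun w => ?_
    by_cases hw : w = v
    · subst hw
      rw [UnitaryGroup.evalPlace_inclPlace]
      rfl
    · rw [evalPlace_finPart_eq_psiLoc L Ψ SA hΨ, UnitaryGroup.finPart_inclPlaceAdelic, UnitaryGroup.evalPlace_inclPlace_of_ne (Fp L) L (IsCMField.complexConj L) N J hw,
        UnitaryGroup.evalPlace_inclPlace_of_ne (Fp L) L (IsCMField.complexConj L) N J' hw, map_one]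

end TransportCalculus

end Summit.HodgeConjecture.HodgeConjecture.Cruxes.HLiu418.K2LiuKlingenInnerSectionLocalTransport

end
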